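import Summits.HodgeConjecture.HodgeConjecture.Theorems.AnchorTransportVariationalHodgeQuasiProjective
import Summits.HodgeConjecture.HodgeConjecture.Theorems.AnchorTransportVariationalHodgeCurveBase

/-!
# Route AnchorTransport — `VariationalHodge` (stmt-HodgeConjecture-1076): quasi-projective total spaces over curve bases

Combines `AnchorTransportVariationalHodgeQuasiProjective` (proper + quasi-projective total space ⇒
projective in Hartshorne's sense; `V′ ⟺ V` restricted to `IsQuasiProjectiveOver 𝒳`) with the
curve-base reduction `AnchorTransportVariationalHodgeCurveBase` (granted the named fact
`mumford_smoothCurve_through_two_points`):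

* `variationalHodge_quasiProjective_of_curveBase` — **the crux for quasi-projective total spaces
  (over every smooth irreducible base) follows from its instances over smooth irreducible affine
  CURVES** (`topologicalKrullDim S = 1`) with quasi-projective total space: exactly the statement a
  crux line proves (IdeatorOne `CurveBaseReduction` + the quasi-projectivity every engine needs).
* `variationalHodge_of_projective_curveBase_of_isQuasiProjectiveOver` — **the crux AS FILED follows
  from the projective statement over smooth irreducible affine curves, granted only that the total
  space of a smooth proper family with projective fibres over a smooth irreducible affine CURVE is
  quasi-projective** (`hqp`). `hqp` is the precise residual mis-statement of the decl: it fails for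
  the mixed small resolution of a two-nodal quartic pencil (Atiyah 1958: a smooth proper family of
  K3 surfaces over a smooth affine curve, not projective over any neighbourhood of the special
  point), and it HOLDS for abelian schemes (Raynaud 1970, Thm. XI 1.4: an abelian scheme over a
  normal base of dimension `≤ 1` is projective) — so for abelian families the typing is harmless.
* `variationalHodge_quasiProjective_of_residual`, `variationalHodge_quasiProjective_iff_residual` —
  the repaired crux (`V` + `IsQuasiProjectiveOver 𝒳`) is equivalent, granted Lefschetz `(1,1)`, hard
  Lefschetz and Mumford's curve lemma, to its instances with `n ≥ 4`, `2 ≤ p ≤ n − 2` over smooth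
  irreducible affine curves: the exact target of a line lead after the restatement.
* `isQuasiProjectiveOver_tensorObj`, `isQuasiProjectiveOver_familyPullback_of_isSeparated`,
  `isQuasiProjectiveOver_familyPullback_of_isAffine` — products, and fibre products over a separated
  (e.g. affine) base, of quasi-projective `ℂ`-schemes are quasi-projective: base change of a
  quasi-projective total space along finite / étale covers of the curve base (what a transport
  argument killing monodromy needs) stays inside the repaired crux.
-/

noncomputable section

-- every declaration of this problem lives in `Summit.HodgeConjecture.HodgeConjecture.…` (summit = sub-problem)
set_option linter.dupNamespace false

open CategoryTheory AlgebraicGeometry TopologicalSpace MonoidalCategory Limits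
open Literature.AlgebraicGeometry.Motives Literature.AlgebraicGeometry.HodgeTheory
open Summit.HodgeConjecture.HodgeConjecture.Theses.AnchorTransport

namespace Summit.HodgeConjecture.HodgeConjecture.Theorems

/-- **The crux for quasi-projective total spaces reduces to smooth irreducible affine curve bases.**
If the variational Hodge statement holds for smooth projective families with quasi-projective total
space over smooth irreducible affine `ℂ`-schemes of dimension `1`, it holds for smooth projective
families with quasi-projective total space over every smooth irreducible base:
`variationalHodge_quasiProjective_of_projective` (to projective families over affine bases) ∘
`variationalHodge_projective_of_curveBase` (to affine curves, granted
`mumford_smoothCurve_through_two_points`) ∘ `isQuasiProjectiveOver_of_isClosedImmersion_of_isAffine`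
(back to quasi-projective total spaces over the affine curve). [cite: MumfordAV1970, §6 Lemma] -/
theorem variationalHodge_quasiProjective_of_curveBase (hC : mumford_smoothCurve_through_two_points)
    (h : ∀ ⦃n : ℕ⦄ ⦃𝒳 S : SchemeOver ℂ⦄ (f : 𝒳 ⟶ S), IsSmoothProjectiveFamily f n →
      IsQuasiProjectiveOver 𝒳 →
      IrreducibleSpace S.left → IsAffine S.left → AlgebraicGeometry.Smooth S.hom →
      topologicalKrullDim S.left = 1 →
      ∀ (p : ℕ) (A : complexBetti 𝒳 (2 * p)),
      (∀ s : ComplexPoints S, IsRationalClass (complexBetti.map (fiberι f s) (2 * p) A) ∧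
        IsOfHodgeType n (fiberOver f s) (2 * p) p p (complexBetti.map (fiberι f s) (2 * p) A)) →
      (∃ s₀ : ComplexPoints S,
        complexBetti.map (fiberι f s₀) (2 * p) A ∈ algebraicClasses (fiberOver f s₀) p) →
      ∀ s : ComplexPoints S,
        complexBetti.map (fiberι f s) (2 * p) A ∈ algebraicClasses (fiberOver f s) p)
    ⦃n : ℕ⦄ ⦃𝒳 S : SchemeOver ℂ⦄ (f : 𝒳 ⟶ S) (hf : IsSmoothProjectiveFamily f n)
    (h𝒳 : IsQuasiProjectiveOver 𝒳)
    (hirr : IrreducibleSpace S.left) (hsm : AlgebraicGeometry.Smooth S.hom) (p : ℕ)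
    (A : complexBetti 𝒳 (2 * p))
    (hA : ∀ s : ComplexPoints S, IsRationalClass (complexBetti.map (fiberι f s) (2 * p) A) ∧
      IsOfHodgeType n (fiberOver f s) (2 * p) p p (complexBetti.map (fiberι f s) (2 * p) A))
    (hs₀ : ∃ s₀ : ComplexPoints S,
      complexBetti.map (fiberι f s₀) (2 * p) A ∈ algebraicClasses (fiberOver f s₀) p)
    (s : ComplexPoints S) :
    complexBetti.map (fiberι f s) (2 * p) A ∈ algebraicClasses (fiberOver f s) p :=
  variationalHodge_quasiProjective_of_projective
    (fun _ _ _ f hf hι hirr _ hsm p A hA hs₀ s =>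
      variationalHodge_projective_of_curveBase hC
        (fun _ _ _ f hf hι hirr haff hsm hdim p A hA hs₀ s => by
          haveI := haff
          haveI := hsm
          exact h f hf (isQuasiProjectiveOver_of_isClosedImmersion_of_isAffine hι) hirr haff hsm hdim
            p A hA hs₀ s)
        f hf hι hirr hsm p A hA hs₀ s)
    f hf h𝒳 hirr hsm p A hA hs₀ s

/-- **The crux AS FILED from the projective statement over curves, granted quasi-projectivity of
total spaces over curves.** Reduce the crux to smooth irreducible affine curve bases
(`variationalHodge_of_curveBase`, granted `mumford_smoothCurve_through_two_points`); over such a base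
the hypothesis `hqp` makes the total space quasi-projective, hence the proper family projective in
Hartshorne's sense (`exists_isClosedImmersion_of_isSmoothProjectiveFamily`), and the projective
statement over curves applies. `hqp` — quasi-projectivity of the total space of a smooth proper
family with projective fibres over a smooth irreducible affine CURVE — is the exact residual
difference between the decl and Grothendieck's conjecture; it is false in general (Atiyah-flop
families of K3 surfaces) and true for abelian schemes (Raynaud 1970, Thm. XI 1.4).
[cite: MumfordAV1970, §6 Lemma] -/
theorem variationalHodge_of_projective_curveBase_of_isQuasiProjectiveOver
    (hC : mumford_smoothCurve_through_two_points)
    (hqp : ∀ ⦃n : ℕ⦄ ⦃𝒳 S : SchemeOver ℂ⦄ (f : 𝒳 ⟶ S), IsSmoothProjectiveFamily f n →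
      IrreducibleSpace S.left → IsAffine S.left → AlgebraicGeometry.Smooth S.hom →
      topologicalKrullDim S.left = 1 → IsQuasiProjectiveOver 𝒳)
    (h : ∀ ⦃n : ℕ⦄ ⦃𝒳 S : SchemeOver ℂ⦄ (f : 𝒳 ⟶ S), IsSmoothProjectiveFamily f n →
      (∃ (N : ℕ) (ι : 𝒳 ⟶ projectiveSpace N ℂ ⊗ S), IsClosedImmersion ι.left ∧
        ι ≫ CartesianMonoidalCategory.snd (projectiveSpace N ℂ) S = f) →
      IrreducibleSpace S.left → IsAffine S.left → AlgebraicGeometry.Smooth S.hom →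
      topologicalKrullDim S.left = 1 →
      ∀ (p : ℕ) (A : complexBetti 𝒳 (2 * p)),
      (∀ s : ComplexPoints S, IsRationalClass (complexBetti.map (fiberι f s) (2 * p) A) ∧
        IsOfHodgeType n (fiberOver f s) (2 * p) p p (complexBetti.map (fiberι f s) (2 * p) A)) →
      (∃ s₀ : ComplexPoints S,
        complexBetti.map (fiberι f s₀) (2 * p) A ∈ algebraicClasses (fiberOver f s₀) p) →
      ∀ s : ComplexPoints S,
        complexBetti.map (fiberι f s) (2 * p) A ∈ algebraicClasses (fiberOver f s) p) :
    VariationalHodge :=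
  variationalHodge_of_curveBase hC fun _ _ _ f hf hirr haff hsm hdim p A hA hs₀ s =>
    h f hf (exists_isClosedImmersion_of_isSmoothProjectiveFamily hf (hqp f hf hirr haff hsm hdim))
      hirr haff hsm hdim p A hA hs₀ s

/-- **The residual crux after the repair, for line leads.** Granted Lefschetz `(1,1)` (`hL`), hard
Lefschetz (`hHL`) and Mumford's curve lemma (`hC`), the crux for quasi-projective total spaces (over
every smooth irreducible base, every `p`) follows from its instances with `n ≥ 4`, `2 ≤ p ≤ n − 2`
over smooth irreducible affine CURVES with quasi-projective total space: the other codimensions are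
the Lefschetz range (`variationalHodge_conclusion_of_lefschetzRange`), the other bases reduce by
`variationalHodge_quasiProjective_of_curveBase`. [cite: MumfordAV1970, §6 Lemma]
[cite: VoisinHodgeI2002, Thm. 11.30 and §11.3.3] -/
theorem variationalHodge_quasiProjective_of_residual (hL : lefschetzOneOne_rational)
    (hHL : ∀ (m : ℕ) (Y : SchemeOver ℂ), nonempty_hardLefschetzNFold m Y)
    (hC : mumford_smoothCurve_through_two_points)
    (h : ∀ ⦃n : ℕ⦄ ⦃𝒳 S : SchemeOver ℂ⦄ (f : 𝒳 ⟶ S), IsSmoothProjectiveFamily f n →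
      IsQuasiProjectiveOver 𝒳 →
      IrreducibleSpace S.left → IsAffine S.left → AlgebraicGeometry.Smooth S.hom →
      topologicalKrullDim S.left = 1 →
      ∀ (p : ℕ), 2 ≤ p → p + 2 ≤ n → ∀ (A : complexBetti 𝒳 (2 * p)),
      (∀ s : ComplexPoints S, IsRationalClass (complexBetti.map (fiberι f s) (2 * p) A) ∧
        IsOfHodgeType n (fiberOver f s) (2 * p) p p (complexBetti.map (fiberι f s) (2 * p) A)) →
      (∃ s₀ : ComplexPoints S,
        complexBetti.map (fiberι f s₀) (2 * p) A ∈ algebraicClasses (fiberOver f s₀) p) →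
      ∀ s : ComplexPoints S,
        complexBetti.map (fiberι f s) (2 * p) A ∈ algebraicClasses (fiberOver f s) p)
    ⦃n : ℕ⦄ ⦃𝒳 S : SchemeOver ℂ⦄ (f : 𝒳 ⟶ S) (hf : IsSmoothProjectiveFamily f n)
    (h𝒳 : IsQuasiProjectiveOver 𝒳)
    (hirr : IrreducibleSpace S.left) (hsm : AlgebraicGeometry.Smooth S.hom) (p : ℕ)
    (A : complexBetti 𝒳 (2 * p))
    (hA : ∀ s : ComplexPoints S, IsRationalClass (complexBetti.map (fiberι f s) (2 * p) A) ∧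
      IsOfHodgeType n (fiberOver f s) (2 * p) p p (complexBetti.map (fiberι f s) (2 * p) A))
    (hs₀ : ∃ s₀ : ComplexPoints S,
      complexBetti.map (fiberι f s₀) (2 * p) A ∈ algebraicClasses (fiberOver f s₀) p)
    (s : ComplexPoints S) :
    complexBetti.map (fiberι f s) (2 * p) A ∈ algebraicClasses (fiberOver f s) p := by
  refine variationalHodge_quasiProjective_of_curveBase hC
    (fun n 𝒳 S f hf hq hirr haff hsm hdim p A hA hs₀ s => ?_) f hf h𝒳 hirr hsm p A hA hs₀ s
  by_cases hp : p ≤ 1 ∨ n ≤ p + 1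
  · exact variationalHodge_conclusion_of_lefschetzRange f hL hf hp A s (hHL _ _) (hA s)
  · exact h f hf hq hirr haff hsm hdim p (by omega) (by omega) A hA hs₀ s

/-- **After the repair the crux is `VariationalHodge` + `IsQuasiProjectiveOver 𝒳`, and THAT statement
reduces to the residual range over curves** — packaged as an implication between the two closed
statements (the repaired decl the planner is asked to file, and the target a line lead proves),
granted `hL`, `hHL`, `hC`. [cite: MumfordAV1970, §6 Lemma] -/
theorem variationalHodge_quasiProjective_iff_residual (hL : lefschetzOneOne_rational)
    (hHL : ∀ (m : ℕ) (Y : SchemeOver ℂ), nonempty_hardLefschetzNFold m Y)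
    (hC : mumford_smoothCurve_through_two_points) :
    (∀ ⦃n : ℕ⦄ ⦃𝒳 S : SchemeOver ℂ⦄ (f : 𝒳 ⟶ S), IsSmoothProjectiveFamily f n →
      IsQuasiProjectiveOver 𝒳 →
      IrreducibleSpace S.left → AlgebraicGeometry.Smooth S.hom →
      ∀ (p : ℕ) (A : complexBetti 𝒳 (2 * p)),
      (∀ s : ComplexPoints S, IsRationalClass (complexBetti.map (fiberι f s) (2 * p) A) ∧
        IsOfHodgeType n (fiberOver f s) (2 * p) p p (complexBetti.map (fiberι f s) (2 * p) A)) →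
      (∃ s₀ : ComplexPoints S,
        complexBetti.map (fiberι f s₀) (2 * p) A ∈ algebraicClasses (fiberOver f s₀) p) →
      ∀ s : ComplexPoints S,
        complexBetti.map (fiberι f s) (2 * p) A ∈ algebraicClasses (fiberOver f s) p) ↔
    (∀ ⦃n : ℕ⦄ ⦃𝒳 S : SchemeOver ℂ⦄ (f : 𝒳 ⟶ S), IsSmoothProjectiveFamily f n →
      IsQuasiProjectiveOver 𝒳 →
      IrreducibleSpace S.left → IsAffine S.left → AlgebraicGeometry.Smooth S.hom →
      topologicalKrullDim S.left = 1 →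
      ∀ (p : ℕ), 2 ≤ p → p + 2 ≤ n → ∀ (A : complexBetti 𝒳 (2 * p)),
      (∀ s : ComplexPoints S, IsRationalClass (complexBetti.map (fiberι f s) (2 * p) A) ∧
        IsOfHodgeType n (fiberOver f s) (2 * p) p p (complexBetti.map (fiberι f s) (2 * p) A)) →
      (∃ s₀ : ComplexPoints S,
        complexBetti.map (fiberι f s₀) (2 * p) A ∈ algebraicClasses (fiberOver f s₀) p) →
      ∀ s : ComplexPoints S,
        complexBetti.map (fiberι f s) (2 * p) A ∈ algebraicClasses (fiberOver f s) p) :=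
  ⟨fun hV _ _ _ f hf hq hirr _ hsm _ p _ _ A hA hs₀ s => hV f hf hq hirr hsm p A hA hs₀ s,
    fun h _ _ _ f hf hq hirr hsm p A hA hs₀ s =>
      variationalHodge_quasiProjective_of_residual hL hHL hC h f hf hq hirr hsm p A hA hs₀ s⟩

/-! ### Base change of quasi-projective families (for line leads: finite / étale covers of the curve) -/

/-- **Products of quasi-projective `ℂ`-schemes are quasi-projective**: `j ⊗ j' : 𝒳 ⊗ S' ⟶ P ⊗ P'`
is an open immersion (`pullback.map` of two open immersions) into the projective `P ⊗ P'` (Segre,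
`IsProjectiveOver.tensor`). [cite: Hartshorne1977, Ch. II Ex. 5.11 (Segre embedding) and §4 p. 103] -/
theorem isQuasiProjectiveOver_tensorObj {𝒳 S' : SchemeOver ℂ} (h𝒳 : IsQuasiProjectiveOver 𝒳)
    (hS' : IsQuasiProjectiveOver S') : IsQuasiProjectiveOver (𝒳 ⊗ S') := by
  obtain ⟨P, j, hP, hj⟩ := h𝒳
  obtain ⟨P', j', hP', hj'⟩ := hS'
  refine ⟨P ⊗ P', j ⊗ₘ j', hP.tensor hP', ?_⟩
  rw [Over.tensorHom_left]
  exact MorphismProperty.pullbackMap (P := @IsOpenImmersion) hj hj' (Over.w j).symm (Over.w j').symm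

/-- **Fibre products of quasi-projective `ℂ`-schemes over a separated base are quasi-projective**:
`𝒳 ×_S S' ⟶ 𝒳 ×_ℂ S'` is the base change of the diagonal `S ⟶ S ×_ℂ S` (Mathlib
`pullback_map_diagonal_isPullback`), a closed immersion for `S` separated over `ℂ`, and
`𝒳 ×_ℂ S' = 𝒳 ⊗ S'` is quasi-projective (`isQuasiProjectiveOver_tensorObj`). Use: base change of a
family with quasi-projective total space along a finite or étale cover `S' ⟶ S` of an affine curve
keeps the total space quasi-projective. [cite: Hartshorne1977, Ch. II Cor. 4.6 and §4 p. 103] -/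
theorem isQuasiProjectiveOver_familyPullback_of_isSeparated {𝒳 S S' : SchemeOver ℂ} (f : 𝒳 ⟶ S)
    (g : S' ⟶ S) [IsSeparated S.hom] (h𝒳 : IsQuasiProjectiveOver 𝒳)
    (hS' : IsQuasiProjectiveOver S') : IsQuasiProjectiveOver (familyPullback f g) := by
  -- `𝒳 ×_ℂ S'`, written as a base change over the terminal `ℂ`-scheme, is quasi-projective
  have hY : IsQuasiProjectiveOver (familyPullback (f ≫ CartesianMonoidalCategory.toUnit S)
      (g ≫ CartesianMonoidalCategory.toUnit S)) := by
    rw [CartesianMonoidalCategory.toUnit_unique (f ≫ CartesianMonoidalCategory.toUnit S)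
        (CartesianMonoidalCategory.toUnit 𝒳),
      CartesianMonoidalCategory.toUnit_unique (g ≫ CartesianMonoidalCategory.toUnit S)
        (CartesianMonoidalCategory.toUnit S')]
    exact isQuasiProjectiveOver_tensorObj h𝒳 hS'
  -- the comparison `𝒳 ×_S S' ⟶ 𝒳 ×_ℂ S'` is a closed immersion (base change of the diagonal of `S`)
  let c : familyPullback f g ⟶ familyPullback (f ≫ CartesianMonoidalCategory.toUnit S)
      (g ≫ CartesianMonoidalCategory.toUnit S) :=
    Over.homMk (pullback.map f.left g.left (f.left ≫ S.hom) (g.left ≫ S.hom) (𝟙 _) (𝟙 _) S.hom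
      (Category.id_comp _).symm (Category.id_comp _).symm) (by
        change pullback.map f.left g.left (f.left ≫ S.hom) (g.left ≫ S.hom) (𝟙 _) (𝟙 _) S.hom _ _ ≫
            pullback.fst (f.left ≫ S.hom) (g.left ≫ S.hom) ≫ 𝒳.hom = pullback.fst f.left g.left ≫ 𝒳.hom
        rw [pullback.lift_fst_assoc, Category.comp_id])
  haveI : IsClosedImmersion c.left :=
    MorphismProperty.of_isPullback (P := @IsClosedImmersion)
      (pullback_map_diagonal_isPullback f.left g.left S.hom) inferInstance
  exact IsQuasiProjectiveOver.of_isClosedImmersion c hY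

/-- **Base change of a quasi-projective total space along a map of affine `ℂ`-schemes of finite
type** (e.g. a finite or étale cover `C' ⟶ C` of a smooth affine curve, or any smooth affine curve
`C' ⟶ S` through two points of an affine base): the base-changed family again has quasi-projective
total space (`isQuasiProjectiveOver_familyPullback_of_isSeparated` with `S` affine, hence separated
over `ℂ`, and `S'` affine of finite type, hence quasi-projective). [cite: Hartshorne1977, Ch. II §4 p. 103] -/
theorem isQuasiProjectiveOver_familyPullback_of_isAffine {𝒳 S S' : SchemeOver ℂ} (f : 𝒳 ⟶ S)
    (g : S' ⟶ S) [IsAffine S.left] [IsAffine S'.left] [LocallyOfFiniteType S'.hom]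
    (h𝒳 : IsQuasiProjectiveOver 𝒳) : IsQuasiProjectiveOver (familyPullback f g) := by
  haveI : IsAffineHom S.hom := inferInstance
  haveI : IsSeparated S.hom := IsSeparated.of_isAffineHom S.hom
  exact isQuasiProjectiveOver_familyPullback_of_isSeparated f g h𝒳 (IsQuasiProjectiveOver.of_isAffine S')

end Summit.HodgeConjecture.HodgeConjecture.Theorems

end
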